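import Summits.BirchSwinnertonDyer.BirchSwinnertonDyer.Theorems.GoldfeldAllTwistsTwoConverseTwinHalfTraceSevenModEightAntiOddType
import Summits.BirchSwinnertonDyer.BirchSwinnertonDyer.Theorems.GoldfeldAllTwistsTwoConverseTwinBirchTheoremBPrimeTrace
import Summits.BirchSwinnertonDyer.BirchSwinnertonDyer.Theorems.GoldfeldAllTwistsTwoConverseTwinBirchHalvability
import Summits.BirchSwinnertonDyer.Rank1Residual.AdditivePotMult.TwistPointsOver
import HarnessLib

set_option linter.dupNamespace false
set_option autoImplicit false

/-!
# LINE B49, family F3 (`d_K = −8ℓ`, `ℓ ≡ 7 (mod 8)`): the `k`-UNIFORM Gross–Zagier index bookkeeping —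
# `[X₀(49)(K) : ℤP] = 2k·|n|·(odd)` from "anti-invariant + odd type in `X₀(49)(K)⁻`", and the halvability bit `k` read on
# `X₀(49)(K)⁻` along the twist `W(K) ≅ X₀(49)(K)`

Cell `bsd-goldfeld`, seat `bsd-goldfeld-s1p-c3x` (prover, gen 2; ORDER «B″-F3», `HOME/LANE-BRIEF-S1P-C3X.md` §7), `--supports
stmt-BirchSwinnertonDyer-19140` (route decl `Theses.GoldfeldAllTwistsTwoConverse.BSDTwoCMSevenAdditiveRankOne`, twin″) as a HELPER:
third of the THEOREM B″ files. Theses-free; theorems only; NO definition, NO fact, NO sorry; NO named input at all (pure Mordell–Weil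
algebra and the twist substitution). HONEST FRAMING: bookkeeping; BSD is NOT proved by any of this; item 19140 stays research-open.

## Content

In THEOREM B′ (F2) the factor `[X₀(49)(K) : ℤP] = 2·|n|·m`, `m` odd, came from `P = n • P_K` with `P_K ∉ 2X₀(49)(K) + tors`
(`index_zmultiples_eq_of_oddType_of_torsionOrder`) AND the separately decided halvability bit `k = 1`. On F3 part 2
(`…TwinHalfTraceSevenModEightAntiOddType`) delivers instead `σP_K = −P_K` and `P_K ∉ 2·X₀(49)(K)⁻ + tors` (`σ` the conjugation of
`K`, `X₀(49)(K)⁻ = {R : σR = −R}`), and this file turns that into the index WITHOUT deciding `k`: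
* §1 **`index_zmultiples_eq_of_antiOddType`**: `rank X₀(49)(K) = 1`, `#X₀(49)(K)_tors = 2`, `P = n • P_K` as above, and `k ∈ {1, 2}`
  with `k = 2 ⟺ X₀(49)(K)⁻ ⊆ 2X₀(49)(K) + tors` ⟹ `[X₀(49)(K) : ℤP] = 2k·|n·m|` with `m` ODD. (With `g` a generator mod torsion,
  `g + σg ∈ X₀(49)(ℚ) = {O, T}` (part 2's `eq_zero_or_eq_twoTorsion_of_conjMap_eq`); if `g + σg = O` then `X₀(49)(K)⁻ = X₀(49)(K)`,
  `k = 1`, `P_K = m g + t` with `m` odd; if `g + σg = T` then `X₀(49)(K)⁻ = 2ℤg + tors`, `k = 2`, `P_K = 2b g + t` with `b` odd.)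
* §2 **`forall_halvable_iff_forall_anti_halvable`**: for `W = Cd • X₀(49)^{(d_K)}` the `W`-currency halvability clause of
  `X049BirchLemmaEvenDiscrEight` — «every `y ∈ W(ℚ)` is `2Q + tors` in `W(K)`» — is EQUIVALENT to «every `x ∈ X₀(49)(K)⁻` is
  `2R + tors` in `X₀(49)(K)`»: the twist substitution `Φ : X₀(49)^{(d_K)}(K) ≃ X₀(49)(K)` (cell `b2b-bsdres`' `twistPointEquivOver`) is
  ANTI-natural for `σ` (`map_twistPointEquivOver_of_neg`, `σ√d_K = −√d_K`), so `Φ⁻¹(X₀(49)(K)⁻) = X₀(49)^{(d_K)}(K)^{σ} = ι(X₀(49)^{(d_K)}(ℚ))`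
  (quadratic Galois descent `QuadraticDescent.exists_incl_eq_of_conjMap_eq`), and `Cd` is a `ℚ`-change of variables
  (`pointEquivBaseChange_incl`).

References: B. Gross, D. Zagier, Invent. Math. 84 (1986) V.§2 (p. 311) [GrossZagier1986]; J. H. Silverman, AEC (2009) VIII.6, X.2 Prop. 2.4,
X.5 Cor. 5.4, Exercise 10.16 [SilvermanAEC2009]; T. Dokchitser, *Notes on the parity conjecture* (2013) §4 [Dokchitser2013ParityNotes];
J. H. Silverman, J. Tate (2015) §3.5 [SilvermanTate2015].
-/

noncomputable section

open scoped Classical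

open WeierstrassCurve Literature.NumberTheory.EllipticCurves Literature.NumberTheory.EllipticCurves.ModularForms
  WeierstrassCurve.QuadraticDescent Summit.BirchSwinnertonDyer.Rank1Residual.AdditivePotMult

namespace Summit.BirchSwinnertonDyer.BirchSwinnertonDyer.Theorems.GoldfeldGoodTwists

variable {K : Type} [Field K] [NumberField K]

/-! ## §1 The index from "anti-invariant + odd type in `X₀(49)(K)⁻`", uniform in the halvability bit -/

section Index

/-- With `#X₀(49)(K)_tors = 2`, every torsion point of `X₀(49)(K)` is `O` or `T = (2, −1)`. [cite: SilvermanTate2015, §3.5] -/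
theorem eq_zero_or_eq_twoTorsion_of_isOfFinAddOrder (htK : (cm7.baseChange K).torsionOrder = 2)
    {t : (cm7.baseChange K).toAffine.Point} (ht : IsOfFinAddOrder t) :
    t = 0 ∨ t = Affine.Point.some 2 (-1) (nonsingular_cm7_baseChange_two_neg_one K) := by
  set T := Affine.Point.some 2 (-1) (nonsingular_cm7_baseChange_two_neg_one K) with hT
  have hTfin : IsOfFinAddOrder T :=
    isOfFinAddOrder_iff_nsmul_eq_zero.mpr ⟨2, two_pos, by rw [two_nsmul, cm7_twoTorsion_add_self]⟩
  have hT0 : T ≠ 0 := Affine.Point.some_ne_zero _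
  unfold WeierstrassCurve.torsionOrder at htK
  obtain ⟨y, hy, huniq⟩ := (Nat.card_eq_two_iff' (⟨0, (AddCommGroup.mem_torsion _).mpr IsOfFinAddOrder.zero⟩ :
    AddCommGroup.torsion (cm7.baseChange K).toAffine.Point)).mp htK
  by_cases h0 : t = 0
  · exact Or.inl h0
  · right
    have h1 := huniq ⟨t, (AddCommGroup.mem_torsion _).mpr ht⟩ (fun h ↦ h0 (congrArg Subtype.val h))
    have h2 := huniq ⟨T, (AddCommGroup.mem_torsion _).mpr hTfin⟩ (fun h ↦ hT0 (congrArg Subtype.val h))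
    exact (congrArg Subtype.val h1).trans (congrArg Subtype.val h2).symm

/-- A `ℚ`-endomorphism of `K` fixes `T = (2, −1) ∈ X₀(49)(K)`. [folklore] -/
theorem conjMap_cm7_twoTorsion (σ : K →ₐ[ℚ] K) :
    conjMap cm7 σ (Affine.Point.some 2 (-1) (nonsingular_cm7_baseChange_two_neg_one K)) =
      Affine.Point.some 2 (-1) (nonsingular_cm7_baseChange_two_neg_one K) := by
  rw [Affine.Point.map_some]
  congr 1
  · exact map_ofNat σ 2
  · rw [map_neg, map_one]

/-- **THE `k`-UNIFORM INDEX LEMMA.** `K` a quadratic field with a non-trivial `ℚ`-endomorphism `σ`, `rank X₀(49)(K) = 1`,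
`#X₀(49)(K)_tors = 2`; `P = n • P_K` (`n ≠ 0`) with `σP_K = −P_K` and `P_K ≠ 2R + t` for all `R` with `σR = −R` and all torsion `t`;
`k ∈ {1, 2}` with `k = 2 ⟺` every `x` with `σx = −x` is `2R + tors`. THEN `[X₀(49)(K) : ℤP] = |n·m|·(2k)` with `m` ODD. Proof: for a
generator `g` mod torsion, `g + σg ∈ X₀(49)(K)^σ = {O, T}`; `x = a g + t₁` has `x + σx = a(g + σg)`; if `g + σg = O` every point is
anti-invariant, `k = 1` (a generator is not halvable) and `P_K = m g + t`, `m` odd; if `g + σg = T` the anti-invariant points are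
`2ℤg + tors`, `k = 2`, `P_K = 2b g + t` with `b` odd (else `P_K ∈ 2·X₀(49)(K)⁻ + tors`); index formula `KrizLi2019.index_zmultiples_eq`.
[cite: GrossZagier1986, V.§2 (p. 311)] [cite: SilvermanAEC2009, VIII.6 and Exercise 10.16] -/
theorem index_zmultiples_eq_of_antiOddType (h2 : Module.finrank ℚ K = 2) {σ : K →ₐ[ℚ] K} (hσ : σ ≠ AlgHom.id ℚ K)
    (htK : (cm7.baseChange K).torsionOrder = 2) (hr : (cm7.baseChange K).mordellWeilRank = 1)
    {P PK : (cm7.baseChange K).toAffine.Point} {n : ℤ} (hn : n ≠ 0) (hP : P = n • PK)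
    (hanti : conjMap cm7 σ PK = -PK)
    (hodd : ∀ R t : (cm7.baseChange K).toAffine.Point, IsOfFinAddOrder t → conjMap cm7 σ R = -R →
      PK ≠ (2 : ℤ) • R + t)
    {k : ℕ} (hk : k = 1 ∨ k = 2)
    (hkE : k = 2 ↔ ∀ x : (cm7.baseChange K).toAffine.Point, conjMap cm7 σ x = -x →
      ∃ R : (cm7.baseChange K).toAffine.Point, x - (2 : ℤ) • R ∈ AddCommGroup.torsion (cm7.baseChange K).toAffine.Point) :
    ∃ m : ℤ, Odd m ∧ (AddSubgroup.zmultiples P).index = (n * m).natAbs * (2 * k) := by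
  haveI : NeZero (2 : ℚ) := ⟨two_ne_zero⟩
  set T := Affine.Point.some 2 (-1) (nonsingular_cm7_baseChange_two_neg_one K) with hT
  have hT2 : T + T = 0 := cm7_twoTorsion_add_self K
  have hT0 : T ≠ 0 := Affine.Point.some_ne_zero _
  have hσT : conjMap cm7 σ T = T := conjMap_cm7_twoTorsion σ
  have hσσ : ∀ z, σ (σ z) = z := Quadratic.apply_apply_of_ne_id h2 hσ
  -- torsion points: `t ∈ {O, T}`, `σt = t`, `t + t = 0`
  have htor : ∀ t : (cm7.baseChange K).toAffine.Point, IsOfFinAddOrder t → conjMap cm7 σ t = t ∧ t + t = 0 := by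
    intro t ht
    rcases eq_zero_or_eq_twoTorsion_of_isOfFinAddOrder htK ht with rfl | rfl
    · exact ⟨map_zero _, add_zero 0⟩
    · exact ⟨hσT, hT2⟩
  -- a Mordell–Weil basis with ONE element
  obtain ⟨P₁, hP₁⟩ := (cm7.baseChange K).exists_isMordellWeilBasis_holds
  have hB : IsMordellWeilBasis (P₁ ∘ finCongr hr.symm) := isMordellWeilBasis_comp_equiv hP₁ _
  set g := (P₁ ∘ finCongr hr.symm) 0 with hg_def
  have hg : ¬ IsOfFinAddOrder g := by
    intro hfin
    have hne := hB.1.ne_zero 0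
    apply hne
    change (QuotientAddGroup.mk g : mordellWeilModTorsion (cm7.baseChange K)) = 0
    exact (QuotientAddGroup.eq_zero_iff _).mpr ((AddCommGroup.mem_torsion _).mpr hfin)
  have hgen : ∀ y : (cm7.baseChange K).toAffine.Point, ∃ m : ℤ,
      y - m • g ∈ AddCommGroup.torsion (cm7.baseChange K).toAffine.Point := fun y => by
    obtain ⟨a, ha⟩ := exists_sub_zsmul_isOfFinAddOrder_of_isMordellWeilBasis hB y
    exact ⟨a, (AddCommGroup.mem_torsion _).mpr ha⟩
  have hcoord : ∀ y : (cm7.baseChange K).toAffine.Point, ∃ (a : ℤ) (t : (cm7.baseChange K).toAffine.Point),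
      IsOfFinAddOrder t ∧ y = a • g + t := fun y => by
    obtain ⟨a, ha⟩ := exists_sub_zsmul_isOfFinAddOrder_of_isMordellWeilBasis hB y
    exact ⟨a, y - a • g, ha, by abel⟩
  -- a multiple of `g` is torsion only if the coefficient vanishes
  have hzs : ∀ c : ℤ, IsOfFinAddOrder (c • g) → c = 0 := by
    intro c hc
    by_contra hc0
    exact hg (Literature.NumberTheory.EllipticCurves.isOfFinAddOrder_of_zsmul hc0 hc)
  -- `s = g + σg ∈ {O, T}` and `x + σx = a • s` for `x = a g + t`
  set s := g + conjMap cm7 σ g with hs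
  have hsfix : conjMap cm7 σ s = s := by rw [hs, map_add, conjMap_conjMap cm7 hσσ, add_comm]
  have hsum : ∀ (a : ℤ) (t : (cm7.baseChange K).toAffine.Point), IsOfFinAddOrder t →
      (a • g + t) + conjMap cm7 σ (a • g + t) = a • s := by
    intro a t ht
    obtain ⟨hσt, htt⟩ := htor t ht
    rw [map_add, map_zsmul, hσt, hs, smul_add]
    calc a • g + t + (a • conjMap cm7 σ g + t) = a • g + a • conjMap cm7 σ g + (t + t) := by abel
      _ = a • g + a • conjMap cm7 σ g := by rw [htt, add_zero]
  -- anti-invariance read on coordinates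
  have hanti_iff : ∀ x : (cm7.baseChange K).toAffine.Point, conjMap cm7 σ x = -x ↔ x + conjMap cm7 σ x = 0 := fun x =>
    ⟨fun h => by rw [h, add_neg_cancel], fun h => (eq_neg_of_add_eq_zero_right h)⟩
  -- the coordinate of `P_K`
  obtain ⟨a, tP, htP, hPK⟩ := hcoord PK
  have hPsum : a • s = 0 := by rw [← hsum a tP htP, ← hPK]; exact (hanti_iff PK).mp hanti
  rcases eq_zero_or_eq_twoTorsion_of_conjMap_eq h2 hσ hsfix with hs0 | hsT'
  · ---------------------------------------------------------------- case `σg = −g`: everything is anti-invariant, `k = 1`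
    have hall : ∀ x : (cm7.baseChange K).toAffine.Point, conjMap cm7 σ x = -x := by
      intro x
      obtain ⟨b, t, ht, rfl⟩ := hcoord x
      exact (hanti_iff _).mpr (by rw [hsum b t ht, hs0, smul_zero])
    have hk1 : k = 1 := by
      rcases hk with h | h
      · exact h
      · exfalso
        obtain ⟨R, hR⟩ := (hkE.mp h) g (hall g)
        obtain ⟨b, t, ht, rfl⟩ := hcoord R
        have hfin : IsOfFinAddOrder ((1 - 2 * b) • g) := by
          have e : (1 - 2 * b) • g = (g - (2 : ℤ) • (b • g + t)) + (2 : ℤ) • t := by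
            rw [sub_smul, one_smul, mul_smul, smul_add]; abel
          rw [e]
          exact isOfFinAddOrder_add' ((AddCommGroup.mem_torsion _).mp hR) (isOfFinAddOrder_zsmul 2 ht)
        have := hzs _ hfin
        omega
    -- `a` is odd
    have ha : Odd a := by
      by_contra hodd'
      obtain ⟨b, rfl⟩ := Int.not_odd_iff_even.mp hodd'
      refine hodd (b • g) tP htP (hall _) ?_
      rw [hPK, smul_smul, two_mul]
    refine ⟨a, ha, ?_⟩
    have hx : P - (n * a) • g ∈ AddCommGroup.torsion (cm7.baseChange K).toAffine.Point := by
      rw [hP, hPK, mul_smul, smul_add, AddCommGroup.mem_torsion]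
      have e : n • a • g + n • tP - n • a • g = n • tP := by abel
      rw [e]
      exact isOfFinAddOrder_zsmul n htP
    have ha0 : a ≠ 0 := fun h => by simp [h] at ha
    rw [KrizLi2019.index_zmultiples_eq (cm7.baseChange K) hg hgen (mul_ne_zero hn ha0) hx, htK, hk1]
  · ---------------------------------------------------------------- case `g + σg = T`: `X₀(49)(K)⁻ = 2ℤg + tors`, `k = 2`
    have hsT : s = T := by rw [hsT', hT]
    -- `b • T = 0` forces `b` even
    have heven : ∀ b : ℤ, b • s = 0 → Even b := by
      intro b hb
      by_contra hev
      have hbodd : Odd b := Int.not_even_iff_odd.mp hev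
      rw [hsT, zsmul_eq_self_of_odd_of_add_self_eq_zero hT2 hbodd] at hb
      exact hT0 hb
    have hk2 : k = 2 := by
      refine hkE.mpr fun x hx ↦ ?_
      obtain ⟨b, t, ht, rfl⟩ := hcoord x
      have hb : b • s = 0 := by rw [← hsum b t ht]; exact (hanti_iff _).mp hx
      obtain ⟨c, rfl⟩ := heven b hb
      refine ⟨c • g, (AddCommGroup.mem_torsion _).mpr ?_⟩
      have e : (c + c) • g + t - (2 : ℤ) • (c • g) = t := by rw [add_smul, smul_smul, two_mul, add_smul]; abel
      rw [e]; exact ht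
    -- `a = 2b` with `b` odd
    obtain ⟨b, hab⟩ := heven a hPsum
    have hb : Odd b := by
      by_contra hodd'
      obtain ⟨c, rfl⟩ := Int.not_odd_iff_even.mp hodd'
      have hRanti : conjMap cm7 σ ((c + c) • g) = -((c + c) • g) := by
        refine (hanti_iff _).mpr ?_
        have h := hsum (c + c) 0 IsOfFinAddOrder.zero
        rw [add_zero] at h
        rw [h, hsT, ← two_mul, mul_comm, mul_smul, two_smul, hT2, smul_zero]
      refine hodd ((c + c) • g) tP htP hRanti ?_
      rw [hPK, hab, smul_smul]
      congr 1
      ring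
    refine ⟨b, hb, ?_⟩
    have hx : P - (n * (b + b)) • g ∈ AddCommGroup.torsion (cm7.baseChange K).toAffine.Point := by
      rw [hP, hPK, hab, mul_smul, smul_add, AddCommGroup.mem_torsion]
      have e : n • (b + b) • g + n • tP - n • (b + b) • g = n • tP := by abel
      rw [e]
      exact isOfFinAddOrder_zsmul n htP
    have hb0 : b + b ≠ 0 := fun h => by
      have : b = 0 := by omega
      simp [this] at hb
    rw [KrizLi2019.index_zmultiples_eq (cm7.baseChange K) hg hgen (mul_ne_zero hn hb0) hx, htK, hk2]
    have e : (n * (b + b)).natAbs = (n * b).natAbs * 2 := by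
      rw [show n * (b + b) = (n * b) * 2 by ring, Int.natAbs_mul]; rfl
    rw [e]; ring

end Index

/-! ## §2 The halvability bit of `X049BirchLemmaEvenDiscrEight` read on `X₀(49)(K)⁻` -/

section Transport

/-- **`W`-currency halvability ⟺ anti-halvability on `X₀(49)(K)`.** `K` a quadratic field with `d_K` its discriminant and `σ` a
non-trivial `ℚ`-endomorphism, `W = Cd • X₀(49)^{(d_K)}` (any `ℚ`-model of the twist). Then
«`∀ y ∈ W(ℚ), ∃ Q ∈ W(K), ι y − 2Q ∈ tors`» ⟺ «`∀ x ∈ X₀(49)(K)` with `σx = −x`, `∃ R ∈ X₀(49)(K), x − 2R ∈ tors`».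
The twist substitution `Φ_K : X₀(49)^{(d_K)}(K) ≃+ X₀(49)(K)` (`t = θ`, `θ² = d_K`, `σθ = −θ`) is ANTI-natural for `σ`, hence
carries the `σ`-FIXED points of the twist — `= ι(X₀(49)^{(d_K)}(ℚ))` by quadratic Galois descent — onto `X₀(49)(K)⁻`; the
`ℚ`-change of variables `Cd` commutes with `ι` and preserves torsion. [cite: SilvermanAEC2009, X.2 Prop. 2.4 and X.5 Cor. 5.4]
[cite: Dokchitser2013ParityNotes, §4] -/
theorem forall_halvable_iff_forall_anti_halvable (hK : IsImaginaryQuadratic K) {σ : K →ₐ[ℚ] K}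
    (hσ : σ ≠ AlgHom.id ℚ K) (W : WeierstrassCurve ℚ) (Cd : VariableChange ℚ)
    (hW : Cd • cm7.quadraticTwist (NumberField.discr K : ℚ) = W) :
    (∀ y : W.toAffine.Point, ∃ Q : (W.baseChange K).toAffine.Point,
        incl K W y - (2 : ℤ) • Q ∈ AddCommGroup.torsion (W.baseChange K).toAffine.Point) ↔
    (∀ x : (cm7.baseChange K).toAffine.Point, conjMap cm7 σ x = -x →
        ∃ R : (cm7.baseChange K).toAffine.Point,
          x - (2 : ℤ) • R ∈ AddCommGroup.torsion (cm7.baseChange K).toAffine.Point) := by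
  haveI : NeZero (2 : ℚ) := ⟨two_ne_zero⟩
  subst hW
  obtain ⟨h2, -⟩ := hK
  set Et := cm7.quadraticTwist (NumberField.discr K : ℚ) with hEt
  ---------------------------------------------------------------- a square root `θ` of `d_K` in `K`, `θ ∉ ℚ`, `σθ = −θ`
  obtain ⟨θ₀, c, hθ₀, hcθ⟩ := Literature.NumberTheory.QuadraticFields.Quadratic.exists_sq_eq_algebraMap (F := ℚ) (K := K) h2
  obtain ⟨qq, hqq, hdq⟩ := NumberField.exists_discr_eq_mul_sq h2 hθ₀ hcθ
  set θ : K := algebraMap ℚ K qq * θ₀ with hθ_def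
  have hθ : θ ∉ Set.range (algebraMap ℚ K) := by
    rintro ⟨r, hr'⟩
    apply hθ₀
    refine ⟨r / qq, ?_⟩
    have hq' : algebraMap ℚ K qq ≠ 0 := by rw [ne_eq, map_eq_zero]; exact hqq
    rw [map_div₀, hr', hθ_def, mul_div_cancel_left₀ _ hq']
  have hθd : θ ^ 2 = algebraMap ℚ K (NumberField.discr K : ℚ) := by
    rw [hθ_def, mul_pow, hcθ, ← map_pow, ← map_mul, hdq, mul_comm]
  have hσθ : σ θ = -θ := Quadratic.apply_gen_eq_neg_of_ne_id h2 hθ hθd hσ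
  ---------------------------------------------------------------- the two isomorphisms and their Galois behaviour
  set Φ : (Et.baseChange K).toAffine.Point ≃+ (cm7.baseChange K).toAffine.Point :=
    twistPointEquivOver cm7 (A := K) hθ hθd with hΦ
  set e₂ : (Et.baseChange K).toAffine.Point ≃+ ((Cd • Et).baseChange K).toAffine.Point :=
    VariableChange.pointEquivBaseChange Et Cd K with he₂
  have hΦσ : ∀ Q : (Et.baseChange K).toAffine.Point, conjMap cm7 σ (Φ Q) = -Φ (conjMap Et σ Q) := fun Q ↦
    map_twistPointEquivOver_of_neg cm7 hθ hθd hθ hθd σ hσθ Q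
  have he₂σ : ∀ Q : (Et.baseChange K).toAffine.Point, conjMap (Cd • Et) σ (e₂ Q) = e₂ (conjMap Et σ Q) := fun Q ↦
    VariableChange.pointEquivBaseChange_map Et Cd σ Q
  have he₂ι : ∀ z : Et.toAffine.Point, e₂ (incl K Et z) = incl K (Cd • Et) (VariableChange.pointEquiv Et Cd z) := fun z ↦
    pointEquivBaseChange_incl Et Cd z
  constructor
  · ---------------------------------------------------------------- `W`-halvability ⟹ anti-halvability
    intro hall x hx
    -- `Φ⁻¹ x` is `σ`-fixed, hence rational on the twist
    set Qt := Φ.symm x with hQt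
    have hΦQt : Φ Qt = x := Φ.apply_symm_apply x
    have hfix : conjMap Et σ Qt = Qt := by
      apply Φ.injective
      have h := hΦσ Qt
      rw [hΦQt, hx, neg_inj] at h
      rw [← h, hΦQt]
    obtain ⟨z, hz⟩ := WeierstrassCurve.QuadraticDescent.exists_incl_eq_of_conjMap_eq h2 Et hσ hfix
    -- halve its `Cd`-image in `W(K)` and pull back
    obtain ⟨Q, hQ⟩ := hall (VariableChange.pointEquiv Et Cd z)
    refine ⟨Φ (e₂.symm Q), (AddCommGroup.mem_torsion _).mpr ?_⟩
    have hy : incl K (Cd • Et) (VariableChange.pointEquiv Et Cd z) = e₂ (Φ.symm x) := by rw [← he₂ι, hz]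
    have ht : IsOfFinAddOrder (e₂ (Φ.symm x) - (2 : ℤ) • Q) := by
      rw [← hy]; exact (AddCommGroup.mem_torsion _).mp hQ
    have ht' := (Φ.toAddMonoidHom.comp e₂.symm.toAddMonoidHom).isOfFinAddOrder ht
    simpa [map_sub, map_zsmul] using ht'
  · ---------------------------------------------------------------- anti-halvability ⟹ `W`-halvability
    intro hall y
    set z := (VariableChange.pointEquiv Et Cd).symm y with hz
    have hyz : VariableChange.pointEquiv Et Cd z = y := (VariableChange.pointEquiv Et Cd).apply_symm_apply y
    set x := Φ (incl K Et z) with hx_def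
    have hx : conjMap cm7 σ x = -x := by
      rw [hx_def, hΦσ, conjMap_incl]
    obtain ⟨R, hR⟩ := hall x hx
    refine ⟨e₂ (Φ.symm R), (AddCommGroup.mem_torsion _).mpr ?_⟩
    have ht : IsOfFinAddOrder (x - (2 : ℤ) • R) := (AddCommGroup.mem_torsion _).mp hR
    have ht' := (e₂.toAddMonoidHom.comp Φ.symm.toAddMonoidHom).isOfFinAddOrder ht
    have e : (e₂.toAddMonoidHom.comp Φ.symm.toAddMonoidHom) (x - (2 : ℤ) • R) =
        incl K (Cd • Et) y - (2 : ℤ) • e₂ (Φ.symm R) := by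
      rw [map_sub, map_zsmul, AddMonoidHom.comp_apply, AddMonoidHom.comp_apply]
      simp only [AddEquiv.coe_toAddMonoidHom]
      rw [hx_def, Φ.symm_apply_apply, he₂ι, hyz]
    rwa [e] at ht'

end Transport

end Summit.BirchSwinnertonDyer.BirchSwinnertonDyer.Theorems.GoldfeldGoodTwists

end
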